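import Literature.MathematicalPhysics.QuantumManyBody.StateRelaxationObservable
import Literature.MathematicalPhysics.QuantumLattice.SymmetricLocalCertificate
import HarnessLib

/-!
# Local-objective certificates with a state-optimality (KKT) block in the tracial ground state

Topic `Literature/MathematicalPhysics/QuantumLattice` (companion of `SymmetricLocalCertificate` and of
`QuantumManyBody/StateRelaxationObservable`). Everything here is PROVED; no definition and no named
fact is introduced.

`SymmetricLocalCertificate.re_projState_ge_of_local_certificate` reads a certificate for a LOCAL
objective `X` (the finite-volume form of a translation-invariant / "thermodynamic-limit" bootstrap
certificate, Han 2020 §2–3) in the tracial ground state of a sector, with Han's constraint classes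
(positivity, stationarity `⟨[H,O]⟩ = 0`, symmetry `⟨U O U⁻¹⟩ = ⟨O⟩`, conserved charges) and KSDN's
rounding residual. This file adds, for the tracial ground state `ω₀ = A.groundStateFunctional` on
the WHOLE space (the state behind the tree's Koma–Tasaki sourced order parameter
`dWaveSourceDensity`; no sector, because a symmetry-breaking source leaves no particle-number
sector to fix):

* the second-order STATE-OPTIMALITY ("KKT") block `kktForm A G B` of Araújo et al. (2023, Prop. 11) /
  Fawzi–Fawzi–Scalet (2024, §2) with ARBITRARY generators `B` (`0 ≤ ω₀(kktForm A G B)`,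
  `StateRelaxationObservable.groundStateFunctional_kktForm_nonneg`), and
* the ENERGY-CONSTRAINT term `κ (u·1 − E_loc)` of Wang et al. (2024, §III) for a local energy
  `E_loc` whose translates sum to `A` (`Σ_v T_v E_loc T_vᴴ = A` ⇒ `ω₀(E_loc) = E₀(A)/#V`,
  `groundStateFunctional_eq_div_of_sum_conj`),

in one row: an identity
`X − c·1 − κ (u·1 − E_loc) = Σ Λᵢⱼ Oᵢᴴ Oⱼ + (Σₖ (A Xₖ − Xₖ A) + Σₗ (Uₗ Yₗ Uₗᴴ − Yₗ) + Σⱼ (Cⱼ Wⱼ − Wⱼ Cⱼ))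
   + (kktForm A G B + (Σₘ dₘ (Vₘᴴ − Vₘ) + Σₖ aₖ Mₖ))`
with `Λ, G ⪰ 0`, unitaries `Uₗ` and charges `Cⱼ` commuting with `A`, real `dₘ`, contractions `Mₖ`
proves `c − Σₖ ‖aₖ‖ + κ (u − E₀(A)/#V) ≤ Re ω₀(X)`
(`re_groundStateFunctional_ge_of_local_certificate_kkt`; with `κ ≥ 0` and a certified energy cap
`E₀(A)/#V ≤ u`, `…_of_energy_le`). The instantiation for the pair-sourced Hubbard torus and its
window (pull-back) form is `DWaveSourceOnePointWindowCertificate`.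

Null rows used: `ω₀(C W − W C) = 0` for every `C` commuting with `A`
(`groundStateFunctional_comm_eq_zero_of_commute`, via `groundProj_commute_of_commute`: a conserved
charge commutes with the ground projection — the charged words of the window algebra), anti-Hermitian
parts (`re_groundStateFunctional_real_smul_conjTranspose_sub`), contractions
(`neg_norm_le_re_mul_groundStateFunctional`, from `sectorGroundProj_re_mul_projState_ge` at `K = ⊤`).

## References
* J. Wang et al., Phys. Rev. X 14 (2024) 031006, §III, §VI. [cite: WangEtAl2024, §III]
* M. Araújo, I. Klep, A. J. P. Garner, T. Vértesi, M. Navascués, arXiv:2311.18707, §3.2 Prop. 11.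
  [cite: AraujoEtAl2023, §3.2 Prop. 11]
* X. Han, arXiv:2006.06002 (2020), §2 eq. (2)–(3), §3. [cite: Han2020Bootstrap, §3]
* I. Kull, N. Schuch, B. Dive, M. Navascués, Phys. Rev. X 14 (2024) 021008, §5.3. [cite: KullEtAl2024, §5.3]
* O. Bratteli, D. W. Robinson II (1997), Prop. 5.3.19; §6.2.4. [cite: BratteliRobinsonII1997, §6.2.4]
-/

noncomputable section

namespace Literature.MathematicalPhysics.QuantumLattice

open Matrix Finset Literature.MathematicalPhysics.QuantumManyBody.StateRelaxation
open scoped ComplexOrder BigOperators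

variable {n : Type*} [Fintype n] [DecidableEq n]

/-! ### Null rows and bounds of the tracial ground state on the whole space -/

/-- The whole-space sector ground projection is the ground projection: `sectorGroundProj A ⊤ = P₀`
(`minEnergyOn A ⊤ = E₀(A)`). [cite: Tasaki2020, §2.1] -/
theorem sectorGroundProj_top [Nonempty n] {A : Matrix n n ℂ} (hA : A.IsHermitian) :
    A.sectorGroundProj ⊤ = A.groundProj := by
  have hGS : A.sectorGroundSpace ⊤ = A.groundSpace := by
    rw [Matrix.sectorGroundSpace, Matrix.minEnergyOn_top_holds hA, top_inf_eq]
    rfl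
  rw [Matrix.sectorGroundProj, Matrix.groundProj_eq, hGS]

/-- **Conserved charges kill commutators in the tracial ground state**: `C A = A C` ⇒
`ω₀(C W − W C) = 0` (the ground projection commutes with `C`, cyclicity). Han 2020 §2 ("`⟨O⟩ = 0`
unless `O` commutes with the conserved charges"). [cite: Han2020Bootstrap, §2] -/
theorem groundStateFunctional_comm_eq_zero_of_commute {A C : Matrix n n ℂ} (hA : A.IsHermitian)
    (hC : C * A = A * C) (W : Matrix n n ℂ) : A.groundStateFunctional (C * W - W * C) = 0 := by
  rw [Matrix.groundStateFunctional_eq_projState]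
  exact Matrix.projState_commutator_of_commute (Matrix.groundProj_commute_of_commute hA hC) W

/-- Anti-Hermitian parts with a real coefficient have zero real expectation:
`Re ω₀(d • (Vᴴ − V)) = 0`. [cite: Han2020Bootstrap, §2] -/
theorem re_groundStateFunctional_real_smul_conjTranspose_sub (A : Matrix n n ℂ) (d : ℝ)
    (V : Matrix n n ℂ) : (A.groundStateFunctional ((d : ℂ) • (Vᴴ - V))).re = 0 := by
  rw [Matrix.groundStateFunctional_eq_projState]
  exact Matrix.projState_re_real_smul_conjTranspose_sub (Matrix.groundProj_isHermitian A) d V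

/-- **Contractions cost at most their coefficient**: `−‖a‖ ≤ Re (a · ω₀(M))` for a contraction `M`
(`1 − Mᴴ M ⪰ 0`) — the residual step of a rounded certificate, KSDN 2024 §5.3.
[cite: KullEtAl2024, §5.3] -/
theorem neg_norm_le_re_mul_groundStateFunctional [Nonempty n] {A : Matrix n n ℂ} (hA : A.IsHermitian)
    {M : Matrix n n ℂ} (hM : M.IsContraction) (a : ℂ) :
    -‖a‖ ≤ (a * A.groundStateFunctional M).re := by
  have h := Matrix.sectorGroundProj_re_mul_projState_ge hA ⊤ (fun v _ => Submodule.mem_top)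
    top_ne_bot hM a
  rwa [sectorGroundProj_top hA, ← Matrix.groundStateFunctional_eq_projState] at h

/-- **Averaging over a symmetry family**: if every `T_v` commutes with `A` and `T_vᴴ T_v = 1`, and
the translates of `X` sum to `O`, `Σ_v T_v X T_vᴴ = O`, then `ω₀(X) = ω₀(O)/#V` (Bratteli–Robinson II
§6.2.4, periodic states: mean value per site). [cite: BratteliRobinsonII1997, §6.2.4] -/
theorem groundStateFunctional_eq_div_of_sum_conj {A : Matrix n n ℂ} (hA : A.IsHermitian)
    {V' : Type*} [Fintype V'] [Nonempty V'] (T : V' → Matrix n n ℂ)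
    (hT : ∀ v, T v * A = A * T v) (hTT : ∀ v, (T v)ᴴ * T v = 1) {X O : Matrix n n ℂ}
    (hsum : ∑ v, T v * X * (T v)ᴴ = O) :
    A.groundStateFunctional X = A.groundStateFunctional O / (Fintype.card V' : ℂ) := by
  have h : A.groundStateFunctional O = (Fintype.card V' : ℂ) * A.groundStateFunctional X := by
    rw [← hsum, map_sum, Finset.sum_congr rfl fun v _ =>
      Matrix.groundStateFunctional_conj_of_commute hA (hT v) (hTT v) X, Finset.sum_const,
      Finset.card_univ, nsmul_eq_mul]
  rw [h, mul_div_cancel_left₀ _ (Nat.cast_ne_zero.2 Fintype.card_ne_zero)]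

/-- The energy per translate: `Σ_v T_v E_loc T_vᴴ = A` ⇒ `ω₀(E_loc) = E₀(A)/#V`.
[cite: BratteliRobinsonII1997, §6.2.4] -/
theorem groundStateFunctional_localEnergy [Nonempty n] {A : Matrix n n ℂ} (hA : A.IsHermitian)
    {V' : Type*} [Fintype V'] [Nonempty V'] (T : V' → Matrix n n ℂ)
    (hT : ∀ v, T v * A = A * T v) (hTT : ∀ v, (T v)ᴴ * T v = 1) {Eloc : Matrix n n ℂ}
    (hsum : ∑ v, T v * Eloc * (T v)ᴴ = A) :
    A.groundStateFunctional Eloc = ((A.groundEnergy / Fintype.card V' : ℝ) : ℂ) := by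
  rw [groundStateFunctional_eq_div_of_sum_conj hA T hT hTT hsum,
    Matrix.groundStateFunctional_hamiltonian hA, Complex.ofReal_div, Complex.ofReal_natCast]

/-! ### The local-objective certificate with a KKT block and an energy term -/

variable {m : Type*} [Fintype m] [DecidableEq m]
variable {p : Type*} [Fintype p] [DecidableEq p]

/-- Moving the energy term into the objective: `X − c − E = R ⇒ (X − E) − c = R`. [folklore] -/
private theorem sub_sub_comm_eq {G : Type*} [AddCommGroup G] {X c E R : G} (h : X - c - E = R) :
    X - E - c = R := by
  rw [← h]
  abel

/-- **Local-objective certificate with a KKT block and an energy term, tracial ground state.** Let `A`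
be Hermitian on a nonempty index type, `ω₀ = A.groundStateFunctional`, and let the translates of a
local energy `E_loc` under a nonempty finite family of unitaries `T_v` commuting with `A` sum to `A`.
An identity
`X − c·1 − κ (u·1 − E_loc) = Σ Λᵢⱼ Oᵢᴴ Oⱼ + (Σₖ (A Xₖ − Xₖ A) + Σₗ (Uₗ Yₗ Uₗᴴ − Yₗ) + Σⱼ (Cⱼ Wⱼ − Wⱼ Cⱼ))
   + (kktForm A G B + (Σₘ dₘ (Vₘᴴ − Vₘ) + Σₖ aₖ Mₖ))`
with `Λ, G ⪰ 0`, unitaries `Uₗ` and charges `Cⱼ` commuting with `A`, arbitrary generators `B`,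
real `dₘ` and contractions `Mₖ` proves `c − Σₖ ‖aₖ‖ + κ (u − E₀(A)/#V) ≤ Re ω₀(X)`.
Han 2020 §2–3 (constraint classes) with the state-optimality block of Araújo et al. Prop. 11 and the
energy constraint of Wang et al. §III, read through the one-point weak duality
`le_re_map_of_certificate_rows`. [cite: WangEtAl2024, §III] [cite: AraujoEtAl2023, §3.2 Prop. 11]
[cite: Han2020Bootstrap, §3] -/
theorem re_groundStateFunctional_ge_of_local_certificate_kkt [Nonempty n] {A : Matrix n n ℂ}
    (hA : A.IsHermitian) (X Eloc : Matrix n n ℂ)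
    {V' : Type*} [Fintype V'] [Nonempty V'] (T : V' → Matrix n n ℂ)
    (hT : ∀ v, T v * A = A * T v) (hTT : ∀ v, (T v)ᴴ * T v = 1)
    (hsum : ∑ v, T v * Eloc * (T v)ᴴ = A) (κ u : ℝ)
    {Λ : Matrix m m ℂ} (hΛ : Λ.PosSemidef) (O : m → Matrix n n ℂ)
    {κ' : Type*} (s : Finset κ') (Xc : κ' → Matrix n n ℂ)
    {ι : Type*} (t : Finset ι) (U Y : ι → Matrix n n ℂ) (hU : ∀ l ∈ t, U l * A = A * U l)
    (hUU : ∀ l ∈ t, (U l)ᴴ * U l = 1)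
    {γ : Type*} (u' : Finset γ) (C W : γ → Matrix n n ℂ) (hC : ∀ j ∈ u', C j * A = A * C j)
    {G : Matrix p p ℂ} (hG : G.PosSemidef) (B : p → Matrix n n ℂ)
    {δ : Type*} (ah : Finset δ) (dc : δ → ℝ) (V : δ → Matrix n n ℂ)
    {κ'' : Type*} (w : Finset κ'') (a : κ'' → ℂ) (M : κ'' → Matrix n n ℂ)
    (hM : ∀ k ∈ w, (M k).IsContraction) {c : ℝ}
    (hcert : X - (c : ℂ) • (1 : Matrix n n ℂ) -
        ((κ : ℝ) : ℂ) • (((u : ℝ) : ℂ) • (1 : Matrix n n ℂ) - Eloc) =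
      gramForm Λ O +
        (∑ k ∈ s, (A * Xc k - Xc k * A) + ∑ l ∈ t, (U l * Y l * (U l)ᴴ - Y l) +
          ∑ j ∈ u', (C j * W j - W j * C j)) +
        (kktForm A G B + (∑ m' ∈ ah, ((dc m' : ℝ) : ℂ) • ((V m')ᴴ - V m') + ∑ k ∈ w, a k • M k))) :
    c - ∑ k ∈ w, ‖a k‖ + κ * (u - A.groundEnergy / Fintype.card V') ≤
      (A.groundStateFunctional X).re := by
  set ω := A.groundStateFunctional with hω
  have hpos : ∀ x : Matrix n n ℂ, 0 ≤ ω (star x * x) := fun x => by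
    rw [hω, Matrix.star_eq_conjTranspose]; exact Matrix.groundStateFunctional_nonneg A x
  have hone : ω 1 = 1 := Matrix.groundStateFunctional_one hA
  have hnull : ω (∑ k ∈ s, (A * Xc k - Xc k * A) + ∑ l ∈ t, (U l * Y l * (U l)ᴴ - Y l) +
      ∑ j ∈ u', (C j * W j - W j * C j)) = 0 := by
    rw [map_add, map_add, map_sum, map_sum, map_sum]
    have h1 : ∀ k ∈ s, ω (A * Xc k - Xc k * A) = 0 := fun k _ =>
      groundStateFunctional_comm_eq_zero hA (Xc k)
    have h2 : ∀ l ∈ t, ω (U l * Y l * (U l)ᴴ - Y l) = 0 := fun l hl => by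
      rw [map_sub, hω, Matrix.groundStateFunctional_conj_of_commute hA (hU l hl) (hUU l hl), sub_self]
    have h3 : ∀ j ∈ u', ω (C j * W j - W j * C j) = 0 := fun j hj =>
      groundStateFunctional_comm_eq_zero_of_commute hA (hC j hj) (W j)
    rw [Finset.sum_eq_zero h1, Finset.sum_eq_zero h2, Finset.sum_eq_zero h3, add_zero, add_zero]
  have hk : 0 ≤ (ω (kktForm A G B)).re :=
    (Complex.nonneg_iff.mp (groundStateFunctional_kktForm_nonneg hA hG B)).1
  have hres : -(∑ k ∈ w, ‖a k‖) ≤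
      (ω (∑ m' ∈ ah, ((dc m' : ℝ) : ℂ) • ((V m')ᴴ - V m') + ∑ k ∈ w, a k • M k)).re := by
    have hah : (ω (∑ m' ∈ ah, ((dc m' : ℝ) : ℂ) • ((V m')ᴴ - V m'))).re = 0 := by
      rw [map_sum, Complex.re_sum]
      exact Finset.sum_eq_zero fun m' _ =>
        re_groundStateFunctional_real_smul_conjTranspose_sub A (dc m') (V m')
    have hr : -(∑ k ∈ w, ‖a k‖) ≤ (ω (∑ k ∈ w, a k • M k)).re :=
      neg_sum_norm_le_re_map_sum w ω a M fun k hk =>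
        neg_norm_le_re_mul_groundStateFunctional hA (hM k hk) (a k)
    rw [map_add, Complex.add_re, hah, zero_add]
    exact hr
  have h := le_re_map_of_certificate_rows ω hpos hone hΛ O hnull hk hres (sub_sub_comm_eq hcert)
  -- `ω(X − κ(u·1 − E_loc)) = ω(X) − κ (u − E₀/#V)`
  have hE : ω (((κ : ℝ) : ℂ) • (((u : ℝ) : ℂ) • (1 : Matrix n n ℂ) - Eloc)) =
      ((κ * (u - A.groundEnergy / Fintype.card V') : ℝ) : ℂ) := by
    rw [map_smul, map_sub, map_smul, hone, hω, groundStateFunctional_localEnergy hA T hT hTT hsum]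
    push_cast
    ring
  rw [map_sub, hE, Complex.sub_re, Complex.ofReal_re] at h
  linarith

/-- **With the energy hypothesis**: `κ ≥ 0` and a certified cap `E₀(A)/#V ≤ u` give
`c − Σₖ ‖aₖ‖ ≤ Re ω₀(X)` — the tracial ground state is feasible for the energy constraint,
Wang et al. 2024 §III; without energy rows take `κ = 0`. [cite: WangEtAl2024, §III] -/
theorem re_groundStateFunctional_ge_of_local_certificate_kkt_of_energy_le [Nonempty n]
    {A : Matrix n n ℂ} (hA : A.IsHermitian) (X Eloc : Matrix n n ℂ)
    {V' : Type*} [Fintype V'] [Nonempty V'] (T : V' → Matrix n n ℂ)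
    (hT : ∀ v, T v * A = A * T v) (hTT : ∀ v, (T v)ᴴ * T v = 1)
    (hsum : ∑ v, T v * Eloc * (T v)ᴴ = A) {κ u : ℝ} (hκ : 0 ≤ κ)
    (hu : A.groundEnergy / Fintype.card V' ≤ u)
    {Λ : Matrix m m ℂ} (hΛ : Λ.PosSemidef) (O : m → Matrix n n ℂ)
    {κ' : Type*} (s : Finset κ') (Xc : κ' → Matrix n n ℂ)
    {ι : Type*} (t : Finset ι) (U Y : ι → Matrix n n ℂ) (hU : ∀ l ∈ t, U l * A = A * U l)
    (hUU : ∀ l ∈ t, (U l)ᴴ * U l = 1)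
    {γ : Type*} (u' : Finset γ) (C W : γ → Matrix n n ℂ) (hC : ∀ j ∈ u', C j * A = A * C j)
    {G : Matrix p p ℂ} (hG : G.PosSemidef) (B : p → Matrix n n ℂ)
    {δ : Type*} (ah : Finset δ) (dc : δ → ℝ) (V : δ → Matrix n n ℂ)
    {κ'' : Type*} (w : Finset κ'') (a : κ'' → ℂ) (M : κ'' → Matrix n n ℂ)
    (hM : ∀ k ∈ w, (M k).IsContraction) {c : ℝ}
    (hcert : X - (c : ℂ) • (1 : Matrix n n ℂ) -
        ((κ : ℝ) : ℂ) • (((u : ℝ) : ℂ) • (1 : Matrix n n ℂ) - Eloc) =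
      gramForm Λ O +
        (∑ k ∈ s, (A * Xc k - Xc k * A) + ∑ l ∈ t, (U l * Y l * (U l)ᴴ - Y l) +
          ∑ j ∈ u', (C j * W j - W j * C j)) +
        (kktForm A G B + (∑ m' ∈ ah, ((dc m' : ℝ) : ℂ) • ((V m')ᴴ - V m') + ∑ k ∈ w, a k • M k))) :
    c - ∑ k ∈ w, ‖a k‖ ≤ (A.groundStateFunctional X).re := by
  have h := re_groundStateFunctional_ge_of_local_certificate_kkt hA X Eloc T hT hTT hsum κ u hΛ O s Xc
    t U Y hU hUU u' C W hC hG B ah dc V w a M hM hcert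
  have hslack : 0 ≤ κ * (u - A.groundEnergy / Fintype.card V') := mul_nonneg hκ (sub_nonneg.2 hu)
  linarith

end Literature.MathematicalPhysics.QuantumLattice
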